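import Mathlib
import Literature.ModelTheory.ExponentialFields.CylindricalDecompositionProofs
import Literature.NumberTheory.Transcendental.SemialgebraicMapsProofs
import Literature.NumberTheory.Transcendental.KZDirichletScaling
import Summits.KontsevichZagierPeriods.KontsevichZagierPeriods.Theorems.SoloInformedCubulationKit
import HarnessLib

/-!
# SoloInformed — Nash cubulation in dimension one (first rung of the cube volume crux)

`SoloInformedNashCubulation` restricted to `m = 1` is a THEOREM: every `ℚ`-semialgebraic
`K ⊆ [0,1]` is, up to finitely many points, a disjoint union of open intervals with real-algebraic
end points, each the image of `(0,1)` under an affine map `s ↦ a + (b - a) s` with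
`ℚ`-semialgebraic graph and constant Jacobian `b - a`, an algebraic number, i.e. the real part of
a constant cube germ. The proof runs the tree's adapted cylindrical decomposition
(`IsSemialgebraic.exists_cylindricalDecomposition_holds`, [Basu–Pollack–Roy 2006, Cor. 5.7]) at
level `1`: cells of `ℝ¹` are graphs (points) and bands (open intervals) of `ℚ`-semialgebraic
sections over the point `ℝ⁰`; the end bands are unbounded, the graph cells are null.

Main results:
* `soloInformed_nashCubulation_one` — `Nonempty (SoloInformedCubulation K)` for every
  `ℚ`-semialgebraic `K ⊆ [0,1]¹`;
* `soloInformed_cubeVolumeResolution_one` — the indicator representations `[[0,1]¹, 1_K]` are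
  presentable: the `m = 1` case of the crux `SoloInformedCubeVolumeResolution`, unconditionally.

References: Basu–Pollack–Roy 2006, Def. 5.1, Cor. 5.7; BCR 1998, Prop. 2.2.6; KZ 2001 §1.2.
-/

noncomputable section

open scoped BigOperators Topology
open MeasureTheory Set Filter Polynomial
open Literature.ModelTheory.ExponentialFields
open Literature.NumberTheory.Transcendental Literature.NumberTheory.Transcendental.KZ

namespace Summit.KontsevichZagierPeriods.KontsevichZagierPeriods.Theorems

/-! ### Dimension one -/

/-- **Nash cubulation in dimension one.** Every `ℚ`-semialgebraic `K ⊆ [0,1]¹` admits a Nash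
cubulation datum: the bounded bands of an adapted cylindrical decomposition of `ℝ¹`, charted
affinely by `(0,1)`, cover `K` up to the finitely many graph cells.
[Basu–Pollack–Roy 2006, Cor. 5.7 with Def. 5.1] -/
theorem soloInformed_nashCubulation_one (K : Set (Fin 1 → ℝ)) (hK : IsSemialgebraic ℚ K)
    (hKc : K ⊆ soloInformedCube 1) : Nonempty (SoloInformedCubulation K) := by
  classical
  obtain ⟨𝒮, hcd, hF⟩ := IsSemialgebraic.exists_cylindricalDecomposition_holds (k := ℚ)
    ({K} : Finset (Set (Fin 1 → ℝ))) (by simpa using hK)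
  obtain ⟨𝒞, h𝒞𝒮, h𝒞K⟩ := hF K (by simp)
  obtain ⟨-, hsemi, 𝒮₀, h0, hstack⟩ := isCylindricalDecomposition_succ.1 hcd
  have h0' : 𝒮₀ = {univ} := isCylindricalDecomposition_zero.1 h0
  subst h0'
  obtain ⟨l, ξ, -, hsa, hmono, hcells⟩ := hstack
  -- the sections over the point and their values
  set pt : Fin 0 → ℝ := Fin.elim0 with hpt
  set L := l univ with hL
  set ζ : Fin L → (Fin 0 → ℝ) → ℝ := ξ univ with hζ
  set c : Fin L → ℝ := fun j => ζ j pt with hc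
  have hcmono : StrictMono c := hmono univ (by simp) pt (mem_univ _)
  have hinit : ∀ w : Fin 1 → ℝ, Fin.init w = pt := fun w => Subsingleton.elim _ _
  -- the graph cells are the points `c j`, which are therefore algebraic
  have hgraph : ∀ j : Fin L, graphOver univ (ζ j) = {fun _ => c j} := fun j => by
    ext w
    rw [mem_graphOver_iff, hinit w, mem_singleton_iff]
    simp only [mem_univ, true_and]
    constructor
    · intro h; rw [KZ.eq_const_apply_zero w]; exact congrArg (fun t => fun _ : Fin 1 => t) h
    · intro h; rw [h]
  have halg : ∀ j : Fin L, IsAlgebraic ℚ (c j) := fun j => by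
    have hmem : graphOver univ (ζ j) ∈ 𝒮 := (hcells _).2 ⟨univ, by simp, Or.inl ⟨j, rfl⟩⟩
    have := hsemi _ hmem
    rw [hgraph j] at this
    obtain ⟨F, hF, hloc⟩ := soloInformed_locallyConst_of_isSemialgebraic this
    by_contra hx
    have hxF : c j ∉ F := fun hmem => hx (hF _ hmem)
    have hev : ∀ᶠ y in 𝓝 (fun _ : Fin 1 => c j), y = fun _ => c j :=
      (hloc _ hxF).mono fun y hy => by simpa using hy
    have hev' : ∀ᶠ y in 𝓝[≠] (fun _ : Fin 1 => c j), False := by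
      filter_upwards [nhdsWithin_le_nhds hev, self_mem_nhdsWithin] with y hy hy'
      exact hy' hy
    exact (inferInstance : NeBot (𝓝[≠] fun _ : Fin 1 => c j)).ne
      (eventually_false_iff_eq_bot.1 hev')
  have hconst : ∀ j : Fin L, IsSemialgebraicFunOn ℚ (univ : Set (Fin 1 → ℝ)) fun _ => c j :=
    fun j => by
    have h1 := (hsa univ (by simp) j).comp_init
    have h2 : {v : Fin (0 + 1) → ℝ | Fin.init v ∈ (univ : Set (Fin 0 → ℝ))} = univ := by simp
    rw [h2] at h1
    exact h1.congr fun v _ => by simp only [hinit v, hc, hζ]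
  -- the index set: bands contained in `K`; they are interior bands
  let ι := {j : Fin (L + 1) // bandOver univ ζ j ∈ 𝒞}
  have hsubK : ∀ i : ι, bandOver univ ζ i.1 ⊆ K := fun i => h𝒞K ▸ subset_sUnion_of_mem i.2
  have hne0 : ∀ i : ι, i.1 ≠ 0 := fun i h =>
    soloInformed_band_zero_not_subset ζ ((h ▸ hsubK i).trans hKc)
  have hnel : ∀ i : ι, i.1 ≠ Fin.last L := fun i h =>
    soloInformed_band_last_not_subset ζ ((h ▸ hsubK i).trans hKc)
  set lo : ι → ℝ := fun i => c (i.1.pred (hne0 i)) with hlo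
  set hi : ι → ℝ := fun i => c (i.1.castPred (hnel i)) with hhi
  have hlohi : ∀ i, lo i < hi i := fun i => hcmono (by
    rw [Fin.lt_def, Fin.val_pred, Fin.coe_castPred]
    have h1 : (i.1 : ℕ) ≠ 0 := fun h => hne0 i (Fin.ext h)
    omega)
  have hband : ∀ i : ι, bandOver univ ζ i.1 = {w | ∀ k, lo i < w k ∧ w k < hi i} := fun i =>
    soloInformed_bandOver_eq ζ i.1 (hne0 i) (hnel i)
  have himage : ∀ i : ι, soloInformedAffine (lo i) (hi i) '' soloInformedOpenCube 1 =
      bandOver univ ζ i.1 := fun i => by rw [soloInformed_image_affine (hlohi i), hband i]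
  refine ⟨SoloInformedCubulation.ofFintype (ι := ι) (fun i => soloInformedAffine (lo i) (hi i))
    (fun i _ => (hi i - lo i) • ContinuousLinearMap.id ℝ (Fin 1 → ℝ))
    (fun i => soloInformedConstGerm 1 (hi i - lo i) ((halg _).sub (halg _)))
    (fun i => soloInformed_isSemialgebraicMapOn_affine (hconst _) (hconst _))
    (fun i x _ => (soloInformed_hasFDerivAt_affine _ _ x).hasFDerivWithinAt)
    (fun i => (soloInformed_injective_affine (hlohi i)).injOn)
    (fun i => (himage i).symm ▸ hsubK i) (fun i j hij => ?_) ?_ fun i x _ => ?_⟩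
  · -- distinct interior bands are disjoint
    rw [himage i, himage j, hband i, hband j]
    suffices h : {w : Fin 1 → ℝ | ∀ k, lo i < w k ∧ w k < hi i} ∩
        {w | ∀ k, lo j < w k ∧ w k < hi j} = ∅ by rw [h]; exact measure_empty
    ext w
    simp only [mem_inter_iff, mem_setOf_eq, mem_empty_iff_false, iff_false, not_and]
    intro hwi hwj
    have hij' : i.1 ≠ j.1 := fun h => hij (Subtype.ext h)
    rcases lt_or_gt_of_ne hij' with hlt | hgt
    · have hle : hi i ≤ lo j := hcmono.monotone (by
        rw [Fin.le_def, Fin.val_pred, Fin.coe_castPred]; rw [Fin.lt_def] at hlt; omega)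
      linarith [(hwi 0).2, (hwj 0).1]
    · have hle : hi j ≤ lo i := hcmono.monotone (by
        rw [Fin.le_def, Fin.val_pred, Fin.coe_castPred]; rw [Fin.lt_def] at hgt; omega)
      linarith [(hwj 0).2, (hwi 0).1]
  · -- the uncovered part of `K` consists of graph cells: finitely many points
    refine measure_mono_null (fun v hv => ?_)
      ((Set.finite_range fun j : Fin L => (fun _ => c j : Fin 1 → ℝ)).measure_zero volume)
    obtain ⟨hvK, hvU⟩ := hv
    rw [← h𝒞K, mem_sUnion] at hvK
    obtain ⟨T, hT𝒞, hvT⟩ := hvK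
    obtain ⟨S, hS, hT⟩ := (hcells T).1 (h𝒞𝒮 hT𝒞)
    rw [Finset.mem_singleton] at hS
    subst hS
    rcases hT with ⟨j, rfl⟩ | ⟨j, rfl⟩
    · rw [hgraph j, mem_singleton_iff] at hvT
      exact ⟨j, hvT.symm⟩
    · exact (hvU (mem_iUnion.2 ⟨⟨j, hT𝒞⟩, by rw [himage]; exact hvT⟩)).elim
  · -- the Jacobian is the constant germ `hi - lo`
    rw [det_smul_id_fin, pow_one, abs_of_pos (sub_pos.2 (hlohi i)), soloInformedConstGerm_g]
    simp

/-- **The cube volume crux in dimension one** (a theorem): the indicator representations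
`[[0,1]¹, 1_K]`, `K` `ℚ`-semialgebraic, are presentable. [this file] -/
theorem soloInformed_cubeVolumeResolution_one (K : Set (Fin 1 → ℝ)) (hK : IsSemialgebraic ℚ K)
    (hKc : K ⊆ soloInformedCube 1) :
    of (soloInformedIndicatorRep K hK hKc) ∈ soloInformedPresentable :=
  soloInformed_presentable_indicator_of_cubulation hK hKc
    (soloInformed_nashCubulation_one K hK hKc).some

end Summit.KontsevichZagierPeriods.KontsevichZagierPeriods.Theorems
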